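import Summits.HodgeConjecture.HodgeConjecture.Theorems.MarkmanPartnerTransportRMTypeDefs

/-!
# Route MarkmanPartnerTransport · cruxes `PicardThreeK3Squares` (stmt-HodgeConjecture-19652) /
# `LowPicardRealMultiplication` (stmt-HodgeConjecture-19653) — «COMPONENT ⇒ DOMINATED»: the displayed
# moduli input `RMTypeDominated θ` split into its PRINT-KNOWN part (I1′) and its PRINT-ASSERTED part (I2)

Cell hodge-nonav, line «RM-type descent of the moduli input» (planner p1 g36, memo ROUTE-P1AI §A.6;
assignment 08:53:04Z to prover 19652-p1 g8). The displayed Prop `RMTypeDominated θ`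
(`Theorems/MarkmanPartnerTransportRMTypeDefs`) asks, for every `θ`-generic marked projective K3 surface
`S'` with `θ`-eigen period, an `RMSpreadFamily S' _ (η'⁻¹ θ_ℂ η')` — whose field list is the conjunction
of two inputs of different print status:

* **(I1′) PRINT-KNOWN** (Huybrechts, *Lectures on K3 Surfaces*, Ch. 6 §4.2: the fine moduli space
  `M_d^lev = Γ_ℓ∖N_d` of polarized K3 surfaces with level structure is smooth quasi-projective and carries a
  UNIVERSAL family; Baily–Borel Thm. 6.1.13; Cattani–Deligne–Kaplan Cor. 1.2: the real-multiplication
  locus of the flat class `graph(θ)` is algebraic; the centraliser of `θ` makes `graph(θ)` a FLAT section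
  over a level cover of each of its irreducible components, of dimension `l - 2`): a smooth projective
  family over a smooth irreducible quasi-projective base with a flat degree-`4` section of the fibres —
  the structure `RMComponentFamily` below (data) — which INDUCES `η'⁻¹ θ_ℂ η'` at a fibre `≅ S' ⊗ S'`
  (`RMComponentFamily.Induces`);
* **(I2) PRINT-ASSERTED** per maximal van Geemen–Schütt family (Forum Math. Sigma 13 (2025) e2,
  Thm. 1.1 (9), (11), Thm. 1.2 (2): «`l - 2` moduli», i.e. the classifying morphism to the RM component is
  DOMINANT; §4.8: on every member the section is the ALGEBRAIC class `Γ₁ + Γ₋₁`): the family is dominated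
  by an irreducible cycle-carrying parameter scheme — `RMComponentFamily.IsDominatedByCycles` (a Prop ON
  the data of (I1′): dominance is a property of THAT base, so (I2) cannot be an independent Prop).

Kernel glue (no mathematics, field shuffling only):
* `RMComponentFamily.nonempty_rmSpreadFamily` — (I1′-data) + `Induces hS t` + `IsDominatedByCycles` ⇒
  `Nonempty (RMSpreadFamily S hS t)`; `RMComponentFamily.of_rmSpreadFamily` /
  `RMComponentFamily.nonempty_rmSpreadFamily_iff` — the converse unpacking (the split is LOSSLESS:
  `Nonempty (RMSpreadFamily S hS t) ↔ ∃ F, F.Induces hS t ∧ F.IsDominatedByCycles`);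
* `rmTypeDominated_of_rmComponentFamily` — **ONE dominated component family inducing `η'⁻¹ θ_ℂ η'` on
  every `θ`-generic `θ`-eigen marked K3 gives `RMTypeDominated θ`** (the planner's
  `RMComponentFamily θ → RMDominatingCycleFamily θ → RMTypeDominated θ`, for a type whose RM locus is
  covered by one irreducible base);
* `rmTypeDominated_of_forall_exists_rmComponentFamily` — the sheet-by-sheet form: it suffices that every
  such `S'` lies on SOME dominated component family (the RM locus `Γ_θ∖D_θ` may have two sheets; each is
  covered by its own universal family — a discharge detail kept out of the hypotheses).

Four definitions (one structure, two `Prop`-valued defs, one repackaging `def`), four theorems; nothing asserted, no instance,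
no sorry. `RMComponentFamily` is NOT claimed inhabited with any non-trivial `Induces`/dominance datum.
Prover seat hodge-nonav-19652-p1 (gen 8), `--supports stmt-HodgeConjecture-19652`.

References: Huybrechts, *Lectures on K3 Surfaces* (CUP 2016), Ch. 6 §4.2 (p. 138–139), Thm. 6.1.13;
Cattani–Deligne–Kaplan, JAMS 8 (1995), Cor. 1.2; van Geemen–Schütt, Forum Math. Sigma 13 (2025) e2,
§3.4, Thm. 1.1 (9), (11), Thm. 1.2 (2), §4.8, Rem. 6.5; van Geemen, Michigan Math. J. 56 (2008), §3
(`dim D_θ = l - 2`); Voisin, *Hodge Theory II*, Thm. 4.18, §5.3.1.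
-/

set_option linter.dupNamespace false

noncomputable section

namespace Summit.HodgeConjecture.HodgeConjecture.Theorems.MarkmanPartnerTransport

open CategoryTheory MonoidalCategory CartesianMonoidalCategory AlgebraicGeometry
open Literature.AlgebraicGeometry Literature.AlgebraicGeometry.Motives Literature.AlgebraicGeometry.HodgeTheory
open Literature.AlgebraicGeometry.Surfaces
open Literature.AlgebraicTopology.SingularHomology

/-- `MarkedK3[S, η, p, x]`: VERBATIM the `let MarkedK3 := …` binder of the route declaration
`PicardThreeK3Squares` (as in `…RMTypeDefs`). Local notation only. -/
local notation3 (prettyPrint := false) "MarkedK3[" S ", " η ", " p ", " x "]" =>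
  (p ≠ 0 ∧ (IsIntegralClass p ∧
    (∀ q : complexBetti S (2 * 2), IsIntegralClass q → ∃ n : ℤ, q = n • p) ∧
    (∀ c : complexBetti S (2 * 1), IsIntegralClass c ↔ ∃ v : K3Index → ℤ, η c = fun i => (v i : ℂ)) ∧
    (∀ a b : complexBetti S (2 * 1),
      cupProduct (rfl : 2 * 1 + 2 * 1 = 2 * 2) a b = k3Form (η a) (η b) • p) ∧
    IsOfHodgeType 2 S (2 * 1) 2 0 (LinearEquiv.symm η x) ∧
    (∀ τ : complexBetti S (2 * 1), IsOfHodgeType 2 S (2 * 1) 2 0 τ →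
      ∃ t : ℂ, τ = t • LinearEquiv.symm η x)) ∧
    (k3Form x x = 0 ∧ 0 < (k3Form (star x) x).re ∧
      ∃ u : K3Index → ℤ, k3Form (fun i => (u i : ℂ)) x = 0 ∧ 0 < ∑ i, ∑ j, u i * k3Gram i j * u j))

/-- **(I1′, data) A component family**: a smooth projective family `family : total ⟶ base` (some
relative dimension) with quasi-projective total space over a smooth IRREDUCIBLE quasi-projective base,
together with a CONTINUOUS (= flat) section `flatSection` of the espace étalé `FiberClass family 4` of
`R⁴ family_* ℂ`. Intended instance (NOT constructed in the tree — no moduli carriers): the fibre square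
of the universal family over a level cover of ONE irreducible component (sheet) of the
real-multiplication locus of a rational model endomorphism `θ`, with the flat class `graph(θ)` as the
section (Huybrechts Ch. 6 §4.2 + Cattani–Deligne–Kaplan + centraliser monodromy). Exactly the fields of
`RMSpreadFamily` that do not mention the surface or the cycles.
[cite: Huybrechts2016K3, Ch. 6 §4.2 and Thm. 6.1.13] [cite: CattaniDeligneKaplan1995JAMS, Cor. 1.2]
[cite: VoisinHodgeII2003, §5.3.1 and Thm. 4.18] -/
structure RMComponentFamily where
  /-- The base `B` (intended: a level cover of one RM component sheet). -/
  base : SchemeOver ℂ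
  /-- The total space `𝒳` (intended: the fibre square of the universal K3 family over `B`). -/
  total : SchemeOver ℂ
  /-- The family `g : 𝒳 ⟶ B`. -/
  family : total ⟶ base
  /-- The relative dimension of the family (`4` in the intended instance; not constrained). -/
  relDim : ℕ
  /-- `g` is a smooth projective family of relative dimension `relDim`. -/
  isSmoothProjectiveFamily : IsSmoothProjectiveFamily family relDim
  /-- The total space is quasi-projective over `ℂ`. -/
  total_quasiProjective : IsQuasiProjectiveOver total
  /-- The base is quasi-projective over `ℂ`. -/
  base_quasiProjective : IsQuasiProjectiveOver base
  /-- The base is smooth over `ℂ`. -/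
  base_smooth : AlgebraicGeometry.Smooth base.hom
  /-- The base is irreducible. -/
  base_irreducible : IrreducibleSpace base.left
  /-- The flat family of degree-`4` fibre classes: a section of the espace étalé of `R⁴ g_* ℂ`. -/
  flatSection : ComplexPoints base → FiberClass family (2 * 2)
  /-- The section is continuous (i.e. flat). -/
  flatSection_continuous : Continuous flatSection
  /-- The section is a section of `FiberClass.pt`. -/
  flatSection_pt : ∀ b, (flatSection b).pt = b

namespace RMComponentFamily

/-- **(I1′, the universality clause at one surface) the component family INDUCES `t` on `S`**: some fibre
of `F.family` is identified with `S ⊗ S`, and the value of the flat section there, pulled back to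
`S ⊗ S`, induces the endomorphism `t` of `H²(S(ℂ); ℂ)` as the correspondence `y ↦ pr₁_*(pr₂^* y ∪ γ)`
(complex orientations) — the fields `pt₁`, `fibreIso`, `induces` of `RMSpreadFamily`. Intended instance:
`S` a `θ`-generic marked K3 surface with `θ`-eigen period on the component, `t = η⁻¹ θ_ℂ η`.
[cite: Huybrechts2016K3, Ch. 6 §4.2] [cite: VoisinHodgeII2003, §5.3.1] -/
def Induces (F : RMComponentFamily) {S : SchemeOver ℂ} (hS : IsSmoothProjective 2 S)
    (t : complexBetti S (2 * 1) →ₗ[ℂ] complexBetti S (2 * 1)) : Prop :=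
  ∃ (b : ComplexPoints F.base) (φ : S ⊗ S ≅ fiberOver F.family b), ∀ y : complexBetti S (2 * 1),
    t y = complexGysin complexOrientationFamily (IsSmoothProjective.tensor_holds hS hS) hS
      (SemiCartesianMonoidalCategory.fst S S) (rfl : 2 * 1 + 2 * 2 + 2 * 2 = 2 * 1 + 2 * (2 + 2))
      (cupProduct (rfl : 2 * 1 + 2 * 2 = 2 * 1 + 2 * 2)
        (complexBetti.map (SemiCartesianMonoidalCategory.snd S S) (2 * 1) y)
        (complexBetti.map φ.hom (2 * 2) ((F.flatSection b).clsAt (F.flatSection_pt b))))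

/-- **(I2) the component family IS DOMINATED BY CYCLES**: there is an irreducible, separated, locally
finite-type, non-empty `ℂ`-scheme `V` with a DOMINANT morphism `V ⟶ F.base` over whose complex points
the value of the flat section is an ALGEBRAIC class of the fibre — the fields `param`, `classify`, … ,
`algebraic_over_param` of `RMSpreadFamily`. Intended instance: the classifying morphism of a MAXIMAL van
Geemen–Schütt family (`l - 2` moduli ⇒ dominant), the section being the class of the cycle `Γ₁ + Γ₋₁`
on each member. PRINT-ASSERTED for Thm. 1.1 (9), (11), Thm. 1.2 (2) only; not claimed for any `F` here.
[cite: GeemenSchutt2023, §3.4, Thm. 1.1 (9), (11), Thm. 1.2 (2), §4.8 and Rem. 6.5] -/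
def IsDominatedByCycles (F : RMComponentFamily) : Prop :=
  ∃ (param : SchemeOver ℂ) (classify : param ⟶ F.base),
    IrreducibleSpace param.left ∧ IsSeparated param.hom ∧ LocallyOfFiniteType param.hom ∧
    Nonempty (ComplexPoints param) ∧ DenseRange classify.left.base ∧
    ∀ v : ComplexPoints param,
      (F.flatSection (AlgPoints.map classify v)).clsAt (F.flatSection_pt _) ∈
        algebraicClasses (fiberOver F.family (AlgPoints.map classify v)) 2

/-- **Glue (I1′ + I2 ⇒ spread family), kernel only**: a component family inducing `t` on `S` and
dominated by cycles gives an `RMSpreadFamily S hS t` (assemble the record).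
[cite: GeemenSchutt2023, §3.4 and §4.8] [cite: Huybrechts2016K3, Ch. 6 §4.2] -/
theorem nonempty_rmSpreadFamily (F : RMComponentFamily) {S : SchemeOver ℂ} {hS : IsSmoothProjective 2 S}
    {t : complexBetti S (2 * 1) →ₗ[ℂ] complexBetti S (2 * 1)} (hI : F.Induces hS t)
    (hD : F.IsDominatedByCycles) : Nonempty (RMSpreadFamily S hS t) := by
  obtain ⟨b, φ, hind⟩ := hI
  obtain ⟨param, classify, hirr, hsep, hlft, hne, hdense, halg⟩ := hD
  exact ⟨
    { base := F.base
      total := F.total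
      family := F.family
      relDim := F.relDim
      isSmoothProjectiveFamily := F.isSmoothProjectiveFamily
      total_quasiProjective := F.total_quasiProjective
      base_quasiProjective := F.base_quasiProjective
      base_smooth := F.base_smooth
      base_irreducible := F.base_irreducible
      flatSection := F.flatSection
      flatSection_continuous := F.flatSection_continuous
      flatSection_pt := F.flatSection_pt
      pt₁ := b
      fibreIso := φ
      induces := hind
      param := param
      classify := classify
      param_irreducible := hirr
      param_isSeparated := hsep
      param_locallyOfFiniteType := hlft
      param_nonempty := hne
      classify_denseRange := hdense
      algebraic_over_param := halg }⟩

/-- **The split is lossless (converse unpacking)**: the component family underlying a spread family.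
[cite: GeemenSchutt2023, §3.4] -/
def of_rmSpreadFamily {S : SchemeOver ℂ} {hS : IsSmoothProjective 2 S}
    {t : complexBetti S (2 * 1) →ₗ[ℂ] complexBetti S (2 * 1)} (G : RMSpreadFamily S hS t) :
    RMComponentFamily where
  base := G.base
  total := G.total
  family := G.family
  relDim := G.relDim
  isSmoothProjectiveFamily := G.isSmoothProjectiveFamily
  total_quasiProjective := G.total_quasiProjective
  base_quasiProjective := G.base_quasiProjective
  base_smooth := G.base_smooth
  base_irreducible := G.base_irreducible
  flatSection := G.flatSection
  flatSection_continuous := G.flatSection_continuous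
  flatSection_pt := G.flatSection_pt

/-- **Losslessness**: a spread family for `(S, t)` is exactly a component family inducing `t` on `S`
and dominated by cycles. [cite: GeemenSchutt2023, §3.4 and §4.8] -/
theorem nonempty_rmSpreadFamily_iff {S : SchemeOver ℂ} (hS : IsSmoothProjective 2 S)
    (t : complexBetti S (2 * 1) →ₗ[ℂ] complexBetti S (2 * 1)) :
    Nonempty (RMSpreadFamily S hS t) ↔ ∃ F : RMComponentFamily, F.Induces hS t ∧ F.IsDominatedByCycles := by
  constructor
  · rintro ⟨G⟩
    exact ⟨of_rmSpreadFamily G, ⟨G.pt₁, G.fibreIso, G.induces⟩, ⟨G.param, G.classify, G.param_irreducible,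
      G.param_isSeparated, G.param_locallyOfFiniteType, G.param_nonempty, G.classify_denseRange,
      G.algebraic_over_param⟩⟩
  · rintro ⟨F, hI, hD⟩
    exact F.nonempty_rmSpreadFamily hI hD

end RMComponentFamily

/-- **«COMPONENT ⇒ DOMINATED» (one irreducible base)**: if ONE component family dominated by cycles
induces `η'⁻¹ ∘ θ_ℂ ∘ η'` on EVERY `θ`-generic marked projective K3 surface with `θ`-eigen period (for
`θ` self-adjoint), then `RMTypeDominated θ` — the planner's glue
`RMComponentFamily θ → RMDominatingCycleFamily θ → RMTypeDominated θ`, for a rational RM type whose locus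
is covered by one irreducible base. [cite: GeemenSchutt2023, §3.4, Thm. 1.1 (9), (11) and Thm. 1.2 (2)]
[cite: Huybrechts2016K3, Ch. 6 §4.2] [cite: CattaniDeligneKaplan1995JAMS, Cor. 1.2] -/
theorem rmTypeDominated_of_rmComponentFamily (θ : Matrix K3Index K3Index ℚ) (F : RMComponentFamily)
    (hcov : ∀ (S' : SchemeOver ℂ) (hS' : IsK3Surface S') (η' : complexBetti S' (2 * 1) ≃ₗ[ℂ] (K3Index → ℂ))
      (p' : complexBetti S' (2 * 2)) (y : K3Index → ℂ) (e : ℂ),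
      (∀ a b : K3Index → ℂ, k3Form (thetaC θ a) b = k3Form a (thetaC θ b)) →
      MarkedK3[S', η', p', y] → thetaC θ y = e • y →
      (∀ v : K3Index → ℚ, k3Form (fun i => (v i : ℂ)) y = 0 → θ.mulVec v = 0) →
      F.Induces hS'.isSmoothProjective (η'.symm.toLinearMap ∘ₗ (thetaC θ ∘ₗ η'.toLinearMap)))
    (hD : F.IsDominatedByCycles) : RMTypeDominated θ :=
  fun S' hS' η' p' y e hsa hM hy hgen ↦
    F.nonempty_rmSpreadFamily (hcov S' hS' η' p' y e hsa hM hy hgen) hD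

/-- **«COMPONENT ⇒ DOMINATED», sheet by sheet**: it suffices that every `θ`-generic marked projective K3
surface with `θ`-eigen period lies on SOME component family that induces `η'⁻¹ ∘ θ_ℂ ∘ η'` on it and is
dominated by cycles (the RM locus `Γ_θ∖D_θ` may have two sheets, each with its own universal family;
each maximal van Geemen–Schütt family is defined over `ℚ`, so its image meets every sheet it
dominates — discharge details, not hypotheses). [cite: GeemenSchutt2023, §3.4 and §4.8]
[cite: Vangeemen2008, §3] [cite: Huybrechts2016K3, Ch. 6 §4.2] -/
theorem rmTypeDominated_of_forall_exists_rmComponentFamily (θ : Matrix K3Index K3Index ℚ)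
    (h : ∀ (S' : SchemeOver ℂ) (hS' : IsK3Surface S') (η' : complexBetti S' (2 * 1) ≃ₗ[ℂ] (K3Index → ℂ))
      (p' : complexBetti S' (2 * 2)) (y : K3Index → ℂ) (e : ℂ),
      (∀ a b : K3Index → ℂ, k3Form (thetaC θ a) b = k3Form a (thetaC θ b)) →
      MarkedK3[S', η', p', y] → thetaC θ y = e • y →
      (∀ v : K3Index → ℚ, k3Form (fun i => (v i : ℂ)) y = 0 → θ.mulVec v = 0) →
      ∃ F : RMComponentFamily,
        F.Induces hS'.isSmoothProjective (η'.symm.toLinearMap ∘ₗ (thetaC θ ∘ₗ η'.toLinearMap)) ∧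
        F.IsDominatedByCycles) :
    RMTypeDominated θ := by
  intro S' hS' η' p' y e hsa hM hy hgen
  obtain ⟨F, hI, hD⟩ := h S' hS' η' p' y e hsa hM hy hgen
  exact F.nonempty_rmSpreadFamily hI hD

end Summit.HodgeConjecture.HodgeConjecture.Theorems.MarkmanPartnerTransport

end
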